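import Summits.MatrixMultiplication.MatrixMultiplication.Theorems.SoloBlindCwPowCentroid

/-!
# `T_{cw,2}` is a rigid Kronecker factor for the centroid

For a 3-tensor `t ∈ A ⊗ B ⊗ C` the **centroid** (the "111-algebra" of Jelisiejew–Landsberg–Pal) is
the algebra of triples `(X, Y, Z)` with `(X⊗1⊗1)t = (1⊗Y⊗1)t = (1⊗1⊗Z)t`; it governs block-sum
decompositions (`t` is `⊕`-indecomposable iff its centroid has no idempotents besides `0, 1`).

**Theorem** (`centroid_kroneckerTensor_cwTensor_two`).  Let `S : α → β → γ → K` be any 3-tensor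
over a commutative semiring which is *concise* in the sense that each of the three contractions
`X ↦ (X⊗1⊗1)S`, `Y ↦ (1⊗Y⊗1)S`, `Z ↦ (1⊗1⊗Z)S` is injective.  Then every centroid triple
`(XX, YY, ZZ)` of the Kronecker product `T_{cw,2} ⊠ S` (index types `Fin 3 × α` etc.,
`kroneckerTensor (cwTensor K 2) S`) is `1 ⊗ (X, Y, Z)` for a centroid triple `(X, Y, Z)` of `S`:
the `Fin 3`-off-diagonal blocks vanish and the diagonal blocks are one common triple.

Consequences (over a field): `Cen(T_{cw,2} ⊠ S) ≅ Cen(S)`, so `T_{cw,2} ⊠ S` is `⊕`-indecomposable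
whenever `S` is, with the same (commutative) centroid; iterating, `Cen(T_{cw,2}^{⊠k} ⊠ S) ≅ Cen(S)`.
This is the centroid half of the statement that `T_{cw,2}` is a *rigid Kronecker factor* for tensor
symmetries (the symmetry-Lie-algebra half, `Der(T⊠S) = Der(T)⊗Cen(S) + 1⊗Der(S)`, is proved on
paper only); together they show that no Kronecker-catalytic degeneration
`⟨3^k⟩ ⊠ S ⊕ C ⊵ T_{cw,2}^{⊠k} ⊠ S ⊕ C` exists for any auxiliary tensor `S` — any single such
identity would certify `R̃(T_{cw,2}) = 3`, i.e. `ω = 2`.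

*Proof.*  Combinatorial, over any commutative semiring, reusing the one-coordinate tables of
`SoloBlindCwPowCentroid`: a pair of legs of a support triple of `T_{cw,2}` determines the third, so
each contraction of `T_{cw,2} ⊠ S` collapses to a single block contraction of `S` or to `0`
(`kron_leg₁₋₃`).  For `i ≠ i'` a witness pair completing to `i'` but not completable with `i`
kills the `(i,i')` block after contracting with `S` (conciseness removes the contraction); along the
six support triples the diagonal block contractions are chained to one another.

## References
* J. Jelisiejew, J. M. Landsberg, A. Pal, *Concise tensors of minimal border rank*,
  arXiv:2205.05713, Def. 1.9 / Thm. 1.10 (the 111-algebra).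
* V. Strassen, *Relative bilinear complexity and matrix multiplication*, J. reine angew. Math.
  375/376 (1987).
-/

namespace Summit.MatrixMultiplication.MatrixMultiplication.Theorems

open Finset Literature.Computability.AlgebraicComplexity

section CwKroneckerCentroid

variable {K : Type*} [CommSemiring K]
variable {α β γ : Type*}

/-! ### One-coordinate witness tables (closed Boolean facts on `Fin 3`) -/

/-- Witness killing an off-diagonal block of the *second* leg: `(cwWitB y y', ·, cwWitC y y')`
completes (legs 1,3) to `y'` while `(y, cwWitC y y')` (legs 2,3) is not completable. -/
theorem cwWit_spec₂ : ∀ y y' : Fin 3,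
    cwPair (cwWitB y y') (cwWitC y y') = true ∧ cwFill (cwWitB y y') (cwWitC y y') = y' ∧
      (y ≠ y' → cwPair y (cwWitC y y') = false) := by
  decide

/-- Witness killing an off-diagonal block of the *third* leg: `(cwWitC z z', cwWitB z z', ·)`
completes (legs 1,2) to `z'` while `(cwWitC z z', z)` (legs 1,3) is not completable. -/
theorem cwWit_spec₃ : ∀ z z' : Fin 3,
    cwPair (cwWitC z z') (cwWitB z z') = true ∧ cwFill (cwWitC z z') (cwWitB z z') = z' ∧
      (z ≠ z' → cwPair (cwWitC z z') z = false) := by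
  decide

/-- The six support triples of `T_{cw,2}` read through `cwPair`/`cwFill` on each pair of legs:
for `j ≠ 0`, the triples `(0,j,j)`, `(j,0,j)`, `(j,j,0)`. -/
theorem cwSupport_table : ∀ j : Fin 3, j ≠ 0 →
    (cwPair j j = true ∧ cwFill j j = 0) ∧ (cwPair 0 j = true ∧ cwFill 0 j = j) ∧
      (cwPair j 0 = true ∧ cwFill j 0 = j) := by
  decide

/-! ### Collapse of the three contractions of `T_{cw,2} ⊠ S` -/

/-- Entries of `T_{cw,2} ⊠ S`. -/
theorem kroneckerTensor_cwTensor_two_apply (S : α → β → γ → K) (a : Fin 3 × α) (b : Fin 3 × β)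
    (c : Fin 3 × γ) : kroneckerTensor (cwTensor K 2) S a b c =
      (if cwSupp a.1 b.1 c.1 = true then 1 else 0) * S a.2 b.2 c.2 := by
  rw [kroneckerTensor_apply, cwTensor_two_eq_ite_cwSupp]

/-- First-leg contraction of `T_{cw,2} ⊠ S` collapses to one block contraction of `S`. -/
theorem kron_leg₁ [Fintype α] (S : α → β → γ → K) (XX : Fin 3 × α → Fin 3 × α → K)
    (a : Fin 3 × α)
    (b : Fin 3 × β) (c : Fin 3 × γ) :
    ∑ a', XX a a' * kroneckerTensor (cwTensor K 2) S a' b c =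
      if cwPair b.1 c.1 = true then ∑ p', XX a (cwFill b.1 c.1, p') * S p' b.2 c.2 else 0 := by
  simp_rw [kroneckerTensor_cwTensor_two_apply]
  rw [Fintype.sum_prod_type]
  have key : ∀ i' : Fin 3, (∑ p' : α, XX a (i', p') * ((if cwSupp i' b.1 c.1 = true then (1 : K)
      else 0) * S p' b.2 c.2)) = (∑ p' : α, XX a (i', p') * S p' b.2 c.2) *
        (if cwSupp i' b.1 c.1 = true then 1 else 0) := by
    intro i'
    rw [Finset.sum_mul]
    exact Finset.sum_congr rfl fun p' _ => by ring
  simp_rw [key]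
  rw [sum_mul_ite_eq_of_iff (fun i' => ∑ p' : α, XX a (i', p') * S p' b.2 c.2)
    (fun i' => cwSupp i' b.1 c.1 = true) (cwPair b.1 c.1 = true) (cwFill b.1 c.1)
    (fun i' => cwSupp_iff₁ b.1 c.1 i')]

/-- Second-leg contraction of `T_{cw,2} ⊠ S` collapses to one block contraction of `S`. -/
theorem kron_leg₂ [Fintype β] (S : α → β → γ → K) (YY : Fin 3 × β → Fin 3 × β → K)
    (a : Fin 3 × α)
    (b : Fin 3 × β) (c : Fin 3 × γ) :
    ∑ b', YY b b' * kroneckerTensor (cwTensor K 2) S a b' c =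
      if cwPair a.1 c.1 = true then ∑ q', YY b (cwFill a.1 c.1, q') * S a.2 q' c.2 else 0 := by
  simp_rw [kroneckerTensor_cwTensor_two_apply]
  rw [Fintype.sum_prod_type]
  have key : ∀ j' : Fin 3, (∑ q' : β, YY b (j', q') * ((if cwSupp a.1 j' c.1 = true then (1 : K)
      else 0) * S a.2 q' c.2)) = (∑ q' : β, YY b (j', q') * S a.2 q' c.2) *
        (if cwSupp a.1 j' c.1 = true then 1 else 0) := by
    intro j'
    rw [Finset.sum_mul]
    exact Finset.sum_congr rfl fun q' _ => by ring
  simp_rw [key]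
  rw [sum_mul_ite_eq_of_iff (fun j' => ∑ q' : β, YY b (j', q') * S a.2 q' c.2)
    (fun j' => cwSupp a.1 j' c.1 = true) (cwPair a.1 c.1 = true) (cwFill a.1 c.1)
    (fun j' => cwSupp_iff₂ a.1 c.1 j')]

/-- Third-leg contraction of `T_{cw,2} ⊠ S` collapses to one block contraction of `S`. -/
theorem kron_leg₃ [Fintype γ] (S : α → β → γ → K) (ZZ : Fin 3 × γ → Fin 3 × γ → K)
    (a : Fin 3 × α)
    (b : Fin 3 × β) (c : Fin 3 × γ) :
    ∑ c', ZZ c c' * kroneckerTensor (cwTensor K 2) S a b c' =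
      if cwPair a.1 b.1 = true then ∑ r', ZZ c (cwFill a.1 b.1, r') * S a.2 b.2 r' else 0 := by
  simp_rw [kroneckerTensor_cwTensor_two_apply]
  rw [Fintype.sum_prod_type]
  have key : ∀ k' : Fin 3, (∑ r' : γ, ZZ c (k', r') * ((if cwSupp a.1 b.1 k' = true then (1 : K)
      else 0) * S a.2 b.2 r')) = (∑ r' : γ, ZZ c (k', r') * S a.2 b.2 r') *
        (if cwSupp a.1 b.1 k' = true then 1 else 0) := by
    intro k'
    rw [Finset.sum_mul]
    exact Finset.sum_congr rfl fun r' _ => by ring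
  simp_rw [key]
  rw [sum_mul_ite_eq_of_iff (fun k' => ∑ r' : γ, ZZ c (k', r') * S a.2 b.2 r')
    (fun k' => cwSupp a.1 b.1 k' = true) (cwPair a.1 b.1 = true) (cwFill a.1 b.1)
    (fun k' => cwSupp_iff₃ a.1 b.1 k')]

/-! ### The theorem -/

/-- **`T_{cw,2}` is a rigid Kronecker factor for the centroid.**  Let `S` be a 3-tensor over a
commutative semiring whose three contraction maps `X ↦ (X⊗1⊗1)S`, `Y ↦ (1⊗Y⊗1)S`,
`Z ↦ (1⊗1⊗Z)S` are injective (conciseness).  If block matrices `XX, YY, ZZ` on `Fin 3 × α`,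
`Fin 3 × β`, `Fin 3 × γ` satisfy the centroid equations of `T_{cw,2} ⊠ S`,
`∑_{a'} XX_{a a'} (T⊠S)_{a' b c} = ∑_{b'} YY_{b b'} (T⊠S)_{a b' c} = ∑_{c'} ZZ_{c c'} (T⊠S)_{a b c'}`,
then `(XX, YY, ZZ) = 1_{3} ⊗ (X, Y, Z)` for a centroid triple `(X, Y, Z)` of `S`:
`Cen(T_{cw,2} ⊠ S) = 1 ⊗ Cen(S)`. -/
theorem centroid_kroneckerTensor_cwTensor_two [Fintype α] [Fintype β] [Fintype γ]
    (S : α → β → γ → K)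
    (hA : ∀ X X' : α → α → K,
      (∀ p q r, ∑ p', X p p' * S p' q r = ∑ p', X' p p' * S p' q r) → X = X')
    (hB : ∀ Y Y' : β → β → K,
      (∀ p q r, ∑ q', Y q q' * S p q' r = ∑ q', Y' q q' * S p q' r) → Y = Y')
    (hC : ∀ Z Z' : γ → γ → K,
      (∀ p q r, ∑ r', Z r r' * S p q r' = ∑ r', Z' r r' * S p q r') → Z = Z')
    (XX : Fin 3 × α → Fin 3 × α → K) (YY : Fin 3 × β → Fin 3 × β → K)
    (ZZ : Fin 3 × γ → Fin 3 × γ → K)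
    (hXY : ∀ a b c, ∑ a', XX a a' * kroneckerTensor (cwTensor K 2) S a' b c =
      ∑ b', YY b b' * kroneckerTensor (cwTensor K 2) S a b' c)
    (hYZ : ∀ a b c, ∑ b', YY b b' * kroneckerTensor (cwTensor K 2) S a b' c =
      ∑ c', ZZ c c' * kroneckerTensor (cwTensor K 2) S a b c') :
    ∃ (X : α → α → K) (Y : β → β → K) (Z : γ → γ → K),
      (∀ p q r, ∑ p', X p p' * S p' q r = ∑ q', Y q q' * S p q' r) ∧
      (∀ p q r, ∑ q', Y q q' * S p q' r = ∑ r', Z r r' * S p q r') ∧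
      (∀ i p i' p', XX (i, p) (i', p') = if i = i' then X p p' else 0) ∧
      (∀ j q j' q', YY (j, q) (j', q') = if j = j' then Y q q' else 0) ∧
      (∀ k r k' r', ZZ (k, r) (k', r') = if k = k' then Z r r' else 0) := by
  -- the two families of equations in collapsed form
  have E1 : ∀ (a : Fin 3 × α) (b : Fin 3 × β) (c : Fin 3 × γ),
      (if cwPair b.1 c.1 = true then ∑ p', XX a (cwFill b.1 c.1, p') * S p' b.2 c.2 else 0) =
        (if cwPair a.1 c.1 = true then ∑ q', YY b (cwFill a.1 c.1, q') * S a.2 q' c.2 else 0) := by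
    intro a b c
    rw [← kron_leg₁, ← kron_leg₂]
    exact hXY a b c
  have E2 : ∀ (a : Fin 3 × α) (b : Fin 3 × β) (c : Fin 3 × γ),
      (if cwPair a.1 c.1 = true then ∑ q', YY b (cwFill a.1 c.1, q') * S a.2 q' c.2 else 0) =
        (if cwPair a.1 b.1 = true then ∑ r', ZZ c (cwFill a.1 b.1, r') * S a.2 b.2 r' else 0) := by
    intro a b c
    rw [← kron_leg₂, ← kron_leg₃]
    exact hYZ a b c
  -- (1) off-diagonal blocks vanish
  have offX : ∀ i i' : Fin 3, i ≠ i' → ∀ p p', XX (i, p) (i', p') = 0 := by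
    intro i i' hne
    obtain ⟨h1, h2, h3⟩ := cwWit_spec i i'
    have h := hA (fun p p' => XX (i, p) (i', p')) (fun _ _ => 0) (fun p q r => by
      have e := E1 (i, p) (cwWitB i i', q) (cwWitC i i', r)
      simp only [h1, h2, h3 hne, if_true] at e
      rw [e]
      simp)
    intro p p'
    exact congrFun (congrFun h p) p'
  have offY : ∀ j j' : Fin 3, j ≠ j' → ∀ q q', YY (j, q) (j', q') = 0 := by
    intro j j' hne
    obtain ⟨h1, h2, h3⟩ := cwWit_spec₂ j j'
    have h := hB (fun q q' => YY (j, q) (j', q')) (fun _ _ => 0) (fun p q r => by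
      have e := E1 (cwWitB j j', p) (j, q) (cwWitC j j', r)
      simp only [h1, h2, h3 hne, if_true] at e
      rw [← e]
      simp)
    intro q q'
    exact congrFun (congrFun h q) q'
  have offZ : ∀ k k' : Fin 3, k ≠ k' → ∀ r r', ZZ (k, r) (k', r') = 0 := by
    intro k k' hne
    obtain ⟨h1, h2, h3⟩ := cwWit_spec₃ k k'
    have h := hC (fun r r' => ZZ (k, r) (k', r')) (fun _ _ => 0) (fun p q r => by
      have e := E2 (cwWitC k k', p) (cwWitB k k', q) (k, r)
      simp only [h1, h2, h3 hne, if_true] at e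
      rw [← e]
      simp)
    intro r r'
    exact congrFun (congrFun h r) r'
  -- (2) diagonal blocks: contractions along the six support triples
  -- notation: the three block contractions
  set cX : Fin 3 → α → β → γ → K := fun i p q r => ∑ p', XX (i, p) (i, p') * S p' q r with hcX
  set cY : Fin 3 → α → β → γ → K := fun j p q r => ∑ q', YY (j, q) (j, q') * S p q' r with hcY
  set cZ : Fin 3 → α → β → γ → K := fun k p q r => ∑ r', ZZ (k, r) (k, r') * S p q r' with hcZ
  -- support triple (x, y, z) gives cX x = cY y (from E1) and cY y = cZ z (from E2)
  have link : ∀ x y z : Fin 3, cwPair y z = true → cwFill y z = x → cwPair x z = true →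
      cwFill x z = y → cwPair x y = true → cwFill x y = z →
      (∀ p q r, cX x p q r = cY y p q r) ∧ (∀ p q r, cY y p q r = cZ z p q r) := by
    intro x y z h1 h2 h3 h4 h5 h6
    refine ⟨fun p q r => ?_, fun p q r => ?_⟩
    · have e := E1 (x, p) (y, q) (z, r)
      simp only [h1, h2, h3, h4, if_true] at e
      simpa [hcX, hcY] using e
    · have e := E2 (x, p) (y, q) (z, r)
      simp only [h3, h4, h5, h6, if_true] at e
      simpa [hcY, hcZ] using e
  have one_ne : (1 : Fin 3) ≠ 0 := by decide
  have two_ne : (2 : Fin 3) ≠ 0 := by decide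
  obtain ⟨⟨p11, f11⟩, ⟨p01, f01⟩, ⟨p10, f10⟩⟩ := cwSupport_table 1 one_ne
  obtain ⟨⟨p22, f22⟩, ⟨p02, f02⟩, ⟨p20, f20⟩⟩ := cwSupport_table 2 two_ne
  -- (0,j,j): cX 0 = cY j = cZ j ; (j,0,j): cX j = cY 0 = cZ j ; (j,j,0): cX j = cY j = cZ 0
  obtain ⟨a011, b011⟩ := link 0 1 1 p11 f11 p01 f01 p01 f01
  obtain ⟨a022, b022⟩ := link 0 2 2 p22 f22 p02 f02 p02 f02
  obtain ⟨a101, b101⟩ := link 1 0 1 p01 f01 p11 f11 p10 f10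
  obtain ⟨a202, b202⟩ := link 2 0 2 p02 f02 p22 f22 p20 f20
  obtain ⟨a110, b110⟩ := link 1 1 0 p10 f10 p10 f10 p11 f11
  obtain ⟨a220, b220⟩ := link 2 2 0 p20 f20 p20 f20 p22 f22
  -- all X blocks equal block 0, etc.
  have X1 : (fun p p' => XX (1, p) (1, p')) = fun p p' => XX (0, p) (0, p') :=
    hA _ _ fun p q r => by
      show cX 1 p q r = cX 0 p q r
      rw [a110, ← a011]
  have X2 : (fun p p' => XX (2, p) (2, p')) = fun p p' => XX (0, p) (0, p') :=
    hA _ _ fun p q r => by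
      show cX 2 p q r = cX 0 p q r
      rw [a220, ← a022]
  have Y1 : (fun q q' => YY (1, q) (1, q')) = fun q q' => YY (0, q) (0, q') :=
    hB _ _ fun p q r => by
      show cY 1 p q r = cY 0 p q r
      rw [← a110, a101]
  have Y2 : (fun q q' => YY (2, q) (2, q')) = fun q q' => YY (0, q) (0, q') :=
    hB _ _ fun p q r => by
      show cY 2 p q r = cY 0 p q r
      rw [← a220, a202]
  have Z1 : (fun r r' => ZZ (1, r) (1, r')) = fun r r' => ZZ (0, r) (0, r') :=
    hC _ _ fun p q r => by
      show cZ 1 p q r = cZ 0 p q r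
      rw [← b011, b110]
  have Z2 : (fun r r' => ZZ (2, r) (2, r')) = fun r r' => ZZ (0, r) (0, r') :=
    hC _ _ fun p q r => by
      show cZ 2 p q r = cZ 0 p q r
      rw [← b022, b220]
  have Y1' : ∀ q q', YY (1, q) (1, q') = YY (0, q) (0, q') := fun q q' => congrFun (congrFun Y1 q) q'
  have Z1' : ∀ r r', ZZ (1, r) (1, r') = ZZ (0, r) (0, r') := fun r r' => congrFun (congrFun Z1 r) r'
  refine ⟨fun p p' => XX (0, p) (0, p'), fun q q' => YY (0, q) (0, q'),
    fun r r' => ZZ (0, r) (0, r'), fun p q r => ?_, fun p q r => ?_, ?_, ?_, ?_⟩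
  · -- X.S = Y.S :  cX 0 = cY 1 and block Y₁ = block Y₀
    show cX 0 p q r = cY 0 p q r
    rw [a011]
    simp only [hcY, Y1']
  · -- Y.S = Z.S :  cY 0 = cZ 1 and block Z₁ = block Z₀
    show cY 0 p q r = cZ 0 p q r
    rw [b101]
    simp only [hcZ, Z1']
  · intro i p i' p'
    by_cases h : i = i'
    · subst h
      rw [if_pos rfl]
      fin_cases i
      · rfl
      · exact congrFun (congrFun X1 p) p'
      · exact congrFun (congrFun X2 p) p'
    · rw [if_neg h]
      exact offX i i' h p p'
  · intro j q j' q'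
    by_cases h : j = j'
    · subst h
      rw [if_pos rfl]
      fin_cases j
      · rfl
      · exact congrFun (congrFun Y1 q) q'
      · exact congrFun (congrFun Y2 q) q'
    · rw [if_neg h]
      exact offY j j' h q q'
  · intro k r k' r'
    by_cases h : k = k'
    · subst h
      rw [if_pos rfl]
      fin_cases k
      · rfl
      · exact congrFun (congrFun Z1 r) r'
      · exact congrFun (congrFun Z2 r) r'
    · rw [if_neg h]
      exact offZ k k' h r r'

end CwKroneckerCentroid

end Summit.MatrixMultiplication.MatrixMultiplication.Theorems
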